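import Summits.Ventures.CertifiedManyBodySolver.Downfold.EmeryBoxesHg1223IPC1TrueCorners
import Summits.Ventures.CertifiedManyBodySolver.Downfold.EmeryBoxesHg1223IPC2TrueCorners
import Summits.Ventures.CertifiedManyBodySolver.Downfold.EmeryBoxesHg1223IPC3TrueCorners
import HarnessLib

/-!
# THE ONE-BAND FERMI-SURFACE SHAPE `t′/t` OF THE WHOLE TYPED 3BE BOX `emeryBoxHg1223IP (EmeryBoxesTrilayer)` AT ITS TWO TRUE CORNERS — as the hull of 3 t_pp′-PIECES (true-corner rule per piece,
# §B.87 (i); router/EMERY-SHAPE-CORNERS.tsv «true» rows)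

Venture CertifiedManyBodySolver, cell `pub/hubbard-downfold` (stage S1; INFLATION-RULES-3to1-B §B.87 (i)), seat hubbard-downfold-mod-4 (technique B, g35); namespace
`Summit.Ventures.CertifiedManyBodySolver.Downfold.Emery`. Everything PROVED (0 sorry). WHAT THIS IS NOT: a statement about HgBa₂Ca₂Cu₃O₈ INNER plane (typed companion) — the typed box is SCREENING-GRADE; `U = 0`
one-body kinematics of the σ model. The box's t_pp′ width [0.11, 0.22] is too wide for the t_pp margin of `EmeryMarginLevers` on the whole box (factor 0.78 on the upper slab);
on each of the 3 pieces [0.11, 0.145] ∪ [0.145, 0.185] ∪ [0.185, 0.22] the margins certify (`EmeryBoxesHg1223IPC<i>TrueCorners`), and the hull of the piece windows is bounded by the values at the TRUE corners of the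
whole box (lowest: top piece's low corner (Δ₁, a₁, b₂, c₂); highest: bottom piece's high corner (Δ₂, a₂, b₁, c₁)) — a plain case split on t_pp′.

| filling | **true-corner window (hull of 3 t_pp′-pieces)** | pieces |
|---|---|---|
| n_H = 1.14 (ν = 43/100) | **[-0.3566, -0.2474]** | [0.11, 0.145]: [-0.3385, -0.2474] ∪ [0.145, 0.185]: [-0.3483, -0.2567] ∪ [0.185, 0.22]: [-0.3566, -0.2671] |
| n_H = 1.20 (ν = 2/5) | **[-0.3564, -0.248]** | [0.11, 0.145]: [-0.3388, -0.248] ∪ [0.145, 0.185]: [-0.3483, -0.2573] ∪ [0.185, 0.22]: [-0.3564, -0.2676] |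

Sources: three-band model [HybertsenSchluterChristensen1989, Eq. (1)]; [AndersenEtAl1995, §6]; box rows as cited in the typed object's file.
-/

noncomputable section

namespace Summit.Ventures.CertifiedManyBodySolver.Downfold.Emery

open Real Set

/-- **n_H = 1.14 (ν = 43/100): for every row of the box the one-band Fermi-surface `t′/t` (object E) lies in `[-0.3566, -0.2474]` — its values at the two TRUE corners** (hull of the 3 t_pp′-pieces' true-corner windows; the extreme pieces carry the true corners). [folklore] -/
theorem hg1223IPBox_fsRatio_true_nH114 {Δ a b c : ℝ} (hΔ : Δ ∈ Icc ((123 : ℝ) / 100) ((101 : ℝ) / 50)) (ha : a ∈ Icc ((29 : ℝ) / 25) ((36 : ℝ) / 25)) (hb : b ∈ Icc ((3 : ℝ) / 5) ((19 : ℝ) / 25)) (hc : c ∈ Icc ((11 : ℝ) / 100) ((11 : ℝ) / 50)) :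
    fsRatio Δ a b c (fermiEnergyOf Δ a b c ((43 : ℝ) / 100)) ∈ Icc ((-1783 : ℝ) / 5000) ((-1237 : ℝ) / 5000) := by
  obtain ⟨hc1, hc2⟩ := hc
  rcases le_total c ((29 : ℝ) / 200) with hcut1 | hcut1
  · have h := hg1223IPC1Box_fsRatio_true_nH114 hΔ ha hb ⟨hc1, hcut1⟩
    exact ⟨le_trans (by norm_num) h.1, le_trans h.2 (by norm_num)⟩
  · rcases le_total c ((37 : ℝ) / 200) with hcut2 | hcut2
    · have h := hg1223IPC2Box_fsRatio_true_nH114 hΔ ha hb ⟨hcut1, hcut2⟩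
      exact ⟨le_trans (by norm_num) h.1, le_trans h.2 (by norm_num)⟩
    · have h := hg1223IPC3Box_fsRatio_true_nH114 hΔ ha hb ⟨hcut2, hc2⟩
      exact ⟨le_trans (by norm_num) h.1, le_trans h.2 (by norm_num)⟩

/-- **n_H = 1.20 (ν = 2/5): for every row of the box the one-band Fermi-surface `t′/t` (object E) lies in `[-0.3564, -0.248]` — its values at the two TRUE corners** (hull of the 3 t_pp′-pieces' true-corner windows; the extreme pieces carry the true corners). [folklore] -/
theorem hg1223IPBox_fsRatio_true_nH120 {Δ a b c : ℝ} (hΔ : Δ ∈ Icc ((123 : ℝ) / 100) ((101 : ℝ) / 50)) (ha : a ∈ Icc ((29 : ℝ) / 25) ((36 : ℝ) / 25)) (hb : b ∈ Icc ((3 : ℝ) / 5) ((19 : ℝ) / 25)) (hc : c ∈ Icc ((11 : ℝ) / 100) ((11 : ℝ) / 50)) :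
    fsRatio Δ a b c (fermiEnergyOf Δ a b c ((2 : ℝ) / 5)) ∈ Icc ((-891 : ℝ) / 2500) ((-31 : ℝ) / 125) := by
  obtain ⟨hc1, hc2⟩ := hc
  rcases le_total c ((29 : ℝ) / 200) with hcut1 | hcut1
  · have h := hg1223IPC1Box_fsRatio_true_nH120 hΔ ha hb ⟨hc1, hcut1⟩
    exact ⟨le_trans (by norm_num) h.1, le_trans h.2 (by norm_num)⟩
  · rcases le_total c ((37 : ℝ) / 200) with hcut2 | hcut2
    · have h := hg1223IPC2Box_fsRatio_true_nH120 hΔ ha hb ⟨hcut1, hcut2⟩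
      exact ⟨le_trans (by norm_num) h.1, le_trans h.2 (by norm_num)⟩
    · have h := hg1223IPC3Box_fsRatio_true_nH120 hΔ ha hb ⟨hcut2, hc2⟩
      exact ⟨le_trans (by norm_num) h.1, le_trans h.2 (by norm_num)⟩

end Summit.Ventures.CertifiedManyBodySolver.Downfold.Emery
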